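import Literature.MathematicalPhysics.QuantumFieldTheory.Balaban1983to89.B9DivLetterTransportedInputClasses
import Literature.MathematicalPhysics.QuantumFieldTheory.Balaban1983to89.B9GradLetterTransportedInputClassesPI
import Literature.MathematicalPhysics.QuantumFieldTheory.Balaban1983to89.B9BackgroundsKLevelV1R
import Literature.MathematicalPhysics.QuantumFieldTheory.Balaban1983to89.B9RWSums347DefiniteFaces

/-!
# `Balaban1983to89.B9DivLetterTransportedAtPins` — T. Bałaban, *Propagators for lattice gauge theories in a background field*, Commun. Math. Phys. **99** (1985) 389–434
# [Balaban1985BackgroundPropagators], (3.8) p. 392 + (3.40) p. 397 + (3.35) p. 396 + (3.42) p. 397: THE LETTER `J†_ν(U)` AT THE PINS, LADDER-FREE, WITH ITS SUP TWIN —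
# the two hypotheses `hJT` (print-weighted transported classes, bond → site) and `hJT0` (`𝔠^{(−1)}_{blkBK} → 𝔠^{(−1)}_{blkSK}`) of dag-n06-l's P-HRGDD core
# `B9Thm313WholeRDvsWordIntoBHZP.hasMaj_R_dvs_comp_into_bHZP`, produced BY NAME at node00-def-Y's letters under print's class (3.35)

[4] = T. Bałaban, *Propagators and renormalization transformations for lattice gauge theories. II*, Commun. Math. Phys. **96** (1984) 223–250 [`Balaban1984PropagatorsII`].
statement-level skeleton of published theorems with citation tags; proofs where landed; nothing here is a claim about the Yang–Mills mass gap.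

THE PRINT.  (3.8) p. 392 (`D*_U` along reversed bonds; `J†_ν` reads ONE transported neighbour value); (3.35) p. 396 (the class: `U` is `G`-valued with small plaquette
variables `|U(∂p) − 1| < α₀(Lʲη)²` — whence the ladder holonomy of (3.40)'s shortest contours, `B9GradLetterLadderHolonomy`); (3.40) p. 397; (3.42) p. 397 (the sup norms
`|·|` on blocks, [4] (2.51)); p. 398 remark after (3.47) (*"the choice of powers Lʲη is conventional"*: the `𝔠^{(0)} → 𝔠^{(−1)}` shift costs `L·e^{αδ_F d}` by [4] (2.60)).

WHY THIS FILE (cell `pub-ymgap`, node N06 [B9], seat `pub-ymgap-dag-n06-c` g22; dag-lead g31 WORDS 257 (6)(ii) «LEG (B) AT THE PINS, LADDER-FREE, WITH ITS SUP TWIN»).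
dag-n06-l g32's core of the `hrgdd13` supply (INTENT-12 `hasMaj_R_dvs_comp_into_bHZP`, INTENT-13 its print-currency wrapper) consumes two letters per direction `ν`:
`hJT : HasMaj (bHZKP (taxiB U) s) (bHZP (taxiS U) s) (J†_ν U) (C_J·e^{−δ_J d})` — this seat's `B9DivLetterTransportedInputClasses.hasMaj_JTcoKH_bHZKP_bHZP` (p761464), stated
there MODULO the ladder hypothesis `hlad` — and the sup twin `hJT0 : HasMaj 𝔠^{(−1)}_{blkBK} 𝔠^{(−1)}_{blkSK} (J†_ν U) (C_J⁰·e^{−δ d})` — dag-n06-w5's `B9DivViaGradLettersAtPins.hasMaj_JTcoKH`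
(`ofBlocks blkBK → 𝔠^{(0)}_{blkSK}`) shifted once.  THIS FILE produces both BY NAME so that the certificate LEG is member-level plumbing:
* §1 (any normed algebra) `hasMaj_JTcoKH_cNormR_zero` (w5's sup letter with the source read in `𝔠^{(0)}_{blkBK}` — same values), ★★ `hasMaj_JTcoKH_cNormR_neg_one` (= `hJT0`:
  one `B9PerturbationMajorantAlgebra.hasMaj_shift … (−1)` under the member facts `Facts347`, constant `cR39 b·e^{δ·rJ}·L`, rate `δ − αδ_F`);
* §2 (the matrix algebra, print's class) ★★★ `hasMaj_JTcoKH_bHZKP_bHZP_of_reg335P` (= `hJT` with `hlad` DISCHARGED by `B9GradLetterTransportedInputClassesPI.jLadder_hyp_of_reg335P`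
  on a regime `10L·Mα₀ ≤ K_T`: constant `L⁴c_bb_b(2 + 2L⁴ + 2Θ(K_T)L²)·e^{δ·r}`, `Θ(K_T) = (d+1)·2K_T(1+K_T)e^{4K_T}·L⁶`, every `0 ≤ s ≤ 1`, `δ ≥ 0`; the links are unitary-like
  because `U` is `G`-valued with `G` unit-normed — `B9SectBGpLettersY.norm_le_one_and_inv_of_mem`);
* §3 (the members of record) ★★ `hasMaj_JTcoKH_bHZKP_bHZP_pinsR` ∕ ★★ `hasMaj_JTcoKH_cNormR_neg_one_pinsR`: the same two at `x : MemberY`, `geo9Y x`, `trBasis N`, the R-generic carrier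
  `bg9YR R₁ R₂ x` with `cfg := fun U => U`, SU(N)-valued `U` (`specialUnitaryUnits_le_U1`), print's units `|c_f| = Lᵏ` (`abs_cf_eq_nKT`).

HONEST SCOPE.  By-name composition of landed kinematic letters with the landed (3.35) ladder bound; nothing of [B9]'s propagator estimates asserted; COUNT-NEUTRAL; N06 NOT
discharged; nothing continuum, nothing about the mass gap ∕ Clay.  A NEW file; 0 `def`, no `sorry`, no `axiom`, no `instance`, no `notation`.
-/

noncomputable section

namespace Literature.MathematicalPhysics.QuantumFieldTheory.Balaban1983to89.B9DivLetterTransportedAtPins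

open T4RelativeLadder (UnitaryLike)
open B6GlobalChartV1 (PV blkV1)
open B6Geom246MultiLevelTorus (geomT)
open B6Ineq2142KLevelV1 (β)
open B6KLevelCensusIndexV1 (KIdx kGeo Adm)
open B6Prop22KLevelTorusCensusEta (nKT)
open B9BackgroundsKLevelV1P (bg9KP mem_of_reg335P)
open B9BackgroundsKLevelV1R (RegFamY bg9YR)
open B9PinMembersKLevelV1 (MemberY geo9Y geo9Y_M)
open B9GeoNormsKLevelV1 (geo9K)
open B9Thm34Ext (toB6)
open B11SectG (BlockNorm HasMaj)
open B9Thm312Whole (GeoOK)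
open B9Thm312WholeClasses (cNormR cNormR_loc)
open B9RWSums343to347Whole (Facts347)
open B9PerturbationMajorantAlgebra (hasMaj_shift)
open B9CoReadingCoords (XBK blkBK)
open B9CoReadingCoordsS (XSK blkSK sIK)
open B9CoReadingCoordsTranspose (TrIdx trBasis)
open B9Thm39ReadingCoords (cR39 cR39_nonneg coordBound39 basisBound39)
open B9MultiscaleSmoothPartitionYNear (rNear)
open B9SmoothHolderClassP (bHZP bHZKP)
open B9SmoothHolderClassTClosure (abs_cf_eq_nKT)
open B9SectBGpLettersY (norm_le_one_and_inv_of_mem)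
open B7Prop2SpecialUnitary (specialUnitaryUnits specialUnitaryUnits_le_U1)
open B9GradViaDivLettersTransported (taxiS taxiB)
open B9GradViaDivLettersAtPins (rJ)
open B9DivViaGradLettersAtPins (JTcoKH hasMaj_JTcoKH)
open B9GradLetterTransportedInputClassesPI (jLadder_hyp_of_reg335P)
open B9DivLetterTransportedInputClasses (hasMaj_JTcoKH_bHZKP_bHZP)
open Node00 (SiteY FBondY IBondY CfgY toKT levY parTaxiV)
open Node00.OpsYNablaBridge (chartY)
open LatticeFieldCalculus (supDist)

variable {d ℓ : ℕ} {hd : 1 ≤ d + 1} {hL : Odd (ℓ + 1) ∧ 1 < ℓ + 1} {b₀ b₁ : ℝ}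

/-! ## §1 The sup twin `hJT0`: `J†_ν : 𝔠^{(−1)}_{blkBK} → 𝔠^{(−1)}_{blkSK}` -/

section Sup

variable {𝔸 : Type} [NormedRing 𝔸] [NormedAlgebra ℂ 𝔸] [CompleteSpace 𝔸] [FiniteDimensional ℝ 𝔸]
variable {κ : Type} [Fintype κ]
variable (i : KIdx d ℓ hd hL b₀ b₁) [Fintype (geo9K i).Site] (b : Module.Basis κ ℝ 𝔸) {B : B9.Backgrounds} (cfg : B.Cfg → CfgY 𝔸 i) (U₁ : B.Cfg)
variable {R₀ : ℝ} {H₀ : Prop} {bI : FBondY i → IBondY i}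

/-- ★ **w5's SUP LETTER OF `J†_ν` WITH THE SOURCE READ IN `𝔠^{(0)}`** (same values as `ofBlocks`: `(Lʲη)⁰ = 1`): for unitary-like links and a `1`-faithful `bI`,
`HasMaj 𝔠^{(0)}_{blkBK} 𝔠^{(0)}_{blkSK} (J†_ν U) (cR39 b·e^{δ·rJ}·e^{−δd})`, every `δ ≥ 0`. [cite: Balaban1985BackgroundPropagators, (3.8) p.392 + (3.42) p.397; Balaban1984PropagatorsII, (2.51) p.232] -/
theorem hasMaj_JTcoKH_cNormR_zero (hU : ∀ μ' t, UnitaryLike (cfg U₁ μ' t))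
    (hβ1 : ∀ f : FBondY i, (geomT i.D).dist (β i.hN i.D i.hk (bI f)) (blkV1 i.hN i.D f) ≤ 1) {δ : ℝ} (hδ : 0 ≤ δ)
    (hlen : ∀ y : (geo9K i).Site, 0 ≤ (geo9K i).len y) (ν : Fin (d + 1)) :
    HasMaj (cNormR R₀ H₀ (blkBK i bI) hlen 0) (cNormR R₀ H₀ (blkSK i (sIK i bI)) hlen 0) (JTcoKH i b B cfg ν U₁)
      (fun a a' => cR39 b * Real.exp (δ * rJ d ℓ) * Real.exp (-(δ * (geo9K i).dist a a'))) := by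
  intro y' F hF y
  have h := hasMaj_JTcoKH i b B cfg hβ1 (U₁ := U₁) (fun μ s => hU μ s) hδ (R₀ := R₀) (H₀ := H₀) hlen ν y' F hF y
  rw [cNormR_loc (blkBK i bI) hlen 0 y' F, Real.rpow_zero, one_mul]
  exact h

/-- ★★ **THE SUP TWIN `hJT0`: `J†_ν : 𝔠^{(−1)}_{blkBK} → 𝔠^{(−1)}_{blkSK}`** — the `𝔠^{(0)}` letter shifted once by the p. 398 transfer ([4] (2.60) through the member facts
`Facts347`, cost `L·e^{αδ_F d}`): `HasMaj 𝔠^{(−1)}_{blkBK} 𝔠^{(−1)}_{blkSK} (J†_ν U) (cR39 b·e^{δ·rJ}·L·e^{−(δ − αδ_F)d})`.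
[cite: Balaban1985BackgroundPropagators, (3.8) p.392 + (3.42) p.397 + p.398 (remark after (3.47)); Balaban1984PropagatorsII, (2.51) p.232, Lemma 2.1 (2.60) p.234] -/
theorem hasMaj_JTcoKH_cNormR_neg_one (hG : GeoOK (geo9K i)) {dF : ℕ} {δF α L₀ : ℝ} (hF : Facts347 (geo9K i) R₀ H₀ dF δF α L₀)
    (hU : ∀ μ' t, UnitaryLike (cfg U₁ μ' t))
    (hβ1 : ∀ f : FBondY i, (geomT i.D).dist (β i.hN i.D i.hk (bI f)) (blkV1 i.hN i.D f) ≤ 1) {δ : ℝ} (hδ : 0 ≤ δ) (ν : Fin (d + 1)) :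
    HasMaj (cNormR R₀ H₀ (blkBK i bI) hG.lenle (-1)) (cNormR R₀ H₀ (blkSK i (sIK i bI)) hG.lenle (-1)) (JTcoKH i b B cfg ν U₁)
      (fun a a' => cR39 b * Real.exp (δ * rJ d ℓ) * (geo9K i).L * Real.exp (-((δ - α * δF) * (geo9K i).dist a a'))) := by
  have hC : 0 ≤ cR39 b * Real.exp (δ * rJ d ℓ) := mul_nonneg (cR39_nonneg b) (Real.exp_nonneg _)
  have h := hasMaj_shift hG hF (T := JTcoKH i b B cfg ν U₁) (-1) (by norm_num) hC (hasMaj_JTcoKH_cNormR_zero i b cfg U₁ hU hβ1 hδ hG.lenle ν)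
  rw [zero_add, show |(-1 : ℝ)| = 1 by norm_num] at h
  exact h.mono fun a a' => mul_le_mul_of_nonneg_right (mul_le_mul_of_nonneg_left (le_of_eq (Real.rpow_one _)) hC) (Real.exp_nonneg _)

end Sup

/-! ## §2 The class letter `hJT`, ladder-free, in the matrix algebra under print's (3.35) -/

section Matrix

open scoped Matrix.Norms.L2Operator

variable {N : ℕ} [Nonempty (Fin N)] {G : Subgroup (Matrix (Fin N) (Fin N) ℂ)ˣ}
variable {κ : Type} [Fintype κ]
variable (i : KIdx d ℓ hd hL b₀ b₁) [Fintype (geo9K i).Site] (b : Module.Basis κ ℝ (Matrix (Fin N) (Fin N) ℂ))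
variable {B : B9.Backgrounds} (cfg : B.Cfg → CfgY (Matrix (Fin N) (Fin N) ℂ) i) (U₁ : B.Cfg)
variable {R₀ : ℝ} {H₀ : Prop} {bI : FBondY i → IBondY i}

/-- ★★★ **`hJT` LADDER-FREE: `J†_ν : bHZKP (taxiB U) s → bHZP (taxiS U) s` UNDER PRINT'S CLASS (3.35)** — for `cfg U₁` regular in `bg9KP`'s sense (`Reg335 c α₀`, `c ≤ 10`) with
`G` unit-normed, a `1`-faithful `bI`, print's units `|c_f| = Lᵏ`, and a regime bound `10L·Mα₀ ≤ K_T`: this seat's `hasMaj_JTcoKH_bHZKP_bHZP` with its ladder hypothesis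
DISCHARGED by `jLadder_hyp_of_reg335P` (Θ(α₀) ≤ Θ(K_T) on the regime) and the links unitary-like by `G`-membership.  Constant `L⁴c_bb_b(2 + 2L⁴ + 2Θ(K_T)L²)·e^{δr}`,
`Θ(K_T) = (d+1)·(2K_T(1+K_T)e^{4K_T})·L⁶`, `r = 2(r_near+1) + 2((d+1)(L+1)+2)`; every `0 ≤ s ≤ 1`, `δ ≥ 0`.
[cite: Balaban1985BackgroundPropagators, (3.8) p.392 + (3.40) p.397 + (3.44)–(3.45) p.398 + (3.35) p.396 + (3.69) p.404; Balaban1984PropagatorsII, (2.2) p.224, (2.51)–(2.54) pp.232–233, (2.137) p.247] -/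
theorem hasMaj_JTcoKH_bHZKP_bHZP_of_reg335P
    (hβ1 : ∀ f : FBondY i, (geomT i.D).dist (β i.hN i.D i.hk (bI f)) (blkV1 i.hN i.D f) ≤ 1) (hcf : |i.cf| = (nKT (toKT i) : ℝ))
    (hG1 : ∀ u : (Matrix (Fin N) (Fin N) ℂ)ˣ, u ∈ G → ‖(u : Matrix (Fin N) (Fin N) ℂ)‖ ≤ 1)
    {c α₀ KT : ℝ} (hc : c ≤ 10) (hMα : 0 ≤ (kGeo i).M * α₀) (hK : 10 * (kGeo i).L * ((kGeo i).M * α₀) ≤ KT)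
    (hreg : (bg9KP (Matrix (Fin N) (Fin N) ℂ) G i).Reg335 c α₀ (cfg U₁))
    {s : ℝ} (hs0 : 0 ≤ s) (hs1 : s ≤ 1) {δ : ℝ} (hδ : 0 ≤ δ) (ν : Fin (d + 1)) :
    HasMaj (bHZKP (κ := κ) i b (taxiB i B cfg U₁) (R := R₀) (H := H₀) hs0 hs1)
      (bHZP (κ := κ) i b (taxiS i B cfg U₁) (R := R₀) (H := H₀) hs0 hs1) (JTcoKH i b B cfg ν U₁)
      (fun y y' => ((((ℓ + 1 : ℕ) : ℝ)) ^ 4 * coordBound39 b * basisBound39 b *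
          (2 + 2 * (((ℓ + 1 : ℕ) : ℝ)) ^ 4 + 2 * ((((d + 1 : ℕ) : ℝ)) * (2 * KT * (1 + KT) * Real.exp (4 * KT)) * (((ℓ + 1 : ℕ) : ℝ)) ^ 6) * (((ℓ + 1 : ℕ) : ℝ)) ^ 2)) *
        Real.exp (δ * (2 * (rNear d ℓ + 1) + 2 * (((d : ℝ) + 1) * (((ℓ : ℝ) + 1) + 1) + 2))) * Real.exp (-(δ * (geo9K i).dist y y'))) := by
  have hUL : ∀ (μ' : Fin (d + 1)) (t : Site (PV d ℓ i.m i.K hd hL) 0), UnitaryLike (cfg U₁ μ' t) :=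
    fun μ' t => norm_le_one_and_inv_of_mem G hG1 (mem_of_reg335P i hreg μ' t)
  have hK0 : 0 ≤ 10 * (kGeo i).L * ((kGeo i).M * α₀) := by
    have := B9Eq335PlaquetteAtLettersY.one_le_L i; positivity
  have hKT : 0 ≤ KT := hK0.trans hK
  have hΘ : 0 ≤ (((d + 1 : ℕ) : ℝ)) * (2 * KT * (1 + KT) * Real.exp (4 * KT)) * (((ℓ + 1 : ℕ) : ℝ)) ^ 6 := by positivity
  have hLk : (kGeo i).L = ((ℓ + 1 : ℕ) : ℝ) := rfl
  refine hasMaj_JTcoKH_bHZKP_bHZP i b cfg U₁ hUL hβ1 hcf hs0 hs1 hδ ν hΘ fun x x' hadm => ?_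
  refine (jLadder_hyp_of_reg335P i (cfg U₁) hc hMα hreg hG1 ν x x' hadm).trans (mul_le_mul_of_nonneg_right ?_ (by positivity))
  rw [hLk]
  have hexp : Real.exp (4 * (10 * (((ℓ + 1 : ℕ) : ℝ)) * ((kGeo i).M * α₀))) ≤ Real.exp (4 * KT) := Real.exp_le_exp.2 (by rw [hLk] at hK; linarith)
  rw [hLk] at hK hK0
  have h1 : 2 * (10 * (((ℓ + 1 : ℕ) : ℝ)) * ((kGeo i).M * α₀)) * (1 + 10 * (((ℓ + 1 : ℕ) : ℝ)) * ((kGeo i).M * α₀)) *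
      Real.exp (4 * (10 * (((ℓ + 1 : ℕ) : ℝ)) * ((kGeo i).M * α₀))) ≤ 2 * KT * (1 + KT) * Real.exp (4 * KT) :=
    mul_le_mul (mul_le_mul (by linarith) (by linarith) (by positivity) (by positivity)) hexp (by positivity) (by positivity)
  exact mul_le_mul_of_nonneg_right (mul_le_mul_of_nonneg_left h1 (by positivity)) (by positivity)

end Matrix

/-! ## §3 At the members of record: `geo9Y x`, `trBasis N`, the R-generic carrier `bg9YR R₁ R₂ x`, SU(N)-valued `U` -/

section Members

open scoped Matrix.Norms.L2Operator

variable {N : ℕ} [NeZero N] {Mstar : ℕ}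
variable [∀ x : MemberY d ℓ hd hL b₀ b₁ Mstar, Fintype (geo9Y x).Site]

/-- ★★ **`hJT` AT THE MEMBER, LADDER-FREE** (the LEG's call): at `x : MemberY`, the carrier `bg9YR R₁ R₂ x` read through `fun U => U`, the frame `trBasis N`, an SU(N)-valued
`U` regular in `bg9KP`'s sense (`c10 ≤ 10` — the certificate's `hP … hU`), regime `10L·Mα₀ ≤ K_T`: `J†_ν : bHZKP (taxiB U) s → bHZP (taxiS U) s` with the constant of
`hasMaj_JTcoKH_bHZKP_bHZP_of_reg335P` at `b := trBasis N`. [cite: Balaban1985BackgroundPropagators, (3.8) p.392 + (3.40) p.397 + (3.44)–(3.45) p.398 + (3.35) p.396; Balaban1984PropagatorsII, (2.51)–(2.54) pp.232–233, (2.137) p.247] -/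
theorem hasMaj_JTcoKH_bHZKP_bHZP_pinsR {R₁ R₂ : RegFamY d ℓ hd hL b₀ b₁ Mstar (Matrix (Fin N) (Fin N) ℂ)} (x : MemberY d ℓ hd hL b₀ b₁ Mstar)
    {H : Prop} {bI : FBondY x.toKIdx → IBondY x.toKIdx}
    (hβ1 : ∀ f : FBondY x.toKIdx, (geomT x.toKIdx.D).dist (β x.toKIdx.hN x.toKIdx.D x.toKIdx.hk (bI f)) (blkV1 x.toKIdx.hN x.toKIdx.D f) ≤ 1)
    {U : (bg9YR (Matrix (Fin N) (Fin N) ℂ) (specialUnitaryUnits (Fin N)) R₁ R₂ x).Cfg} {c10 α₀ KT : ℝ} (hc10 : c10 ≤ 10) (hα₀ : 0 ≤ α₀)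
    (hK : 10 * (((ℓ + 1 : ℕ) : ℝ)) * ((geo9Y x).M * α₀) ≤ KT)
    (hreg : (bg9KP (Matrix (Fin N) (Fin N) ℂ) (specialUnitaryUnits (Fin N)) x.toKIdx).Reg335 c10 α₀ U)
    {s : ℝ} (hs0 : 0 ≤ s) (hs1 : s ≤ 1) {δ : ℝ} (hδ : 0 ≤ δ) (ν : Fin (d + 1)) :
    letI : Fintype (geo9K x.toKIdx).Site := (inferInstance : Fintype (geo9Y x).Site)
    HasMaj (bHZKP (κ := TrIdx N) x.toKIdx (trBasis N) (taxiB x.toKIdx (bg9YR (Matrix (Fin N) (Fin N) ℂ) (specialUnitaryUnits (Fin N)) R₁ R₂ x) (fun U => U) U)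
        (R := (1 : ℝ)) (H := H) hs0 hs1)
      (bHZP (κ := TrIdx N) x.toKIdx (trBasis N) (taxiS x.toKIdx (bg9YR (Matrix (Fin N) (Fin N) ℂ) (specialUnitaryUnits (Fin N)) R₁ R₂ x) (fun U => U) U)
        (R := (1 : ℝ)) (H := H) hs0 hs1)
      (JTcoKH x.toKIdx (trBasis N) (bg9YR (Matrix (Fin N) (Fin N) ℂ) (specialUnitaryUnits (Fin N)) R₁ R₂ x) (fun U => U) ν U)
      (fun y y' => ((((ℓ + 1 : ℕ) : ℝ)) ^ 4 * coordBound39 (trBasis N) * basisBound39 (trBasis N) *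
          (2 + 2 * (((ℓ + 1 : ℕ) : ℝ)) ^ 4 + 2 * ((((d + 1 : ℕ) : ℝ)) * (2 * KT * (1 + KT) * Real.exp (4 * KT)) * (((ℓ + 1 : ℕ) : ℝ)) ^ 6) * (((ℓ + 1 : ℕ) : ℝ)) ^ 2)) *
        Real.exp (δ * (2 * (rNear d ℓ + 1) + 2 * (((d : ℝ) + 1) * (((ℓ : ℝ) + 1) + 1) + 2))) * Real.exp (-(δ * (geo9Y x).dist y y'))) := by
  haveI : Nonempty (Fin N) := ⟨⟨0, Nat.pos_of_ne_zero (NeZero.ne N)⟩⟩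
  letI : Fintype (geo9K x.toKIdx).Site := (inferInstance : Fintype (geo9Y x).Site)
  have hG1 : ∀ u : (Matrix (Fin N) (Fin N) ℂ)ˣ, u ∈ specialUnitaryUnits (Fin N) → ‖(u : Matrix (Fin N) (Fin N) ℂ)‖ ≤ 1 := fun u hu => (specialUnitaryUnits_le_U1 hu).1
  have hcf : |x.toKIdx.cf| = (nKT (toKT x.toKIdx) : ℝ) := abs_cf_eq_nKT x.toKIdx x.hcfk
  have hMα : 0 ≤ (kGeo x.toKIdx).M * α₀ := by
    have e : (kGeo x.toKIdx).M = (geo9Y x).M := rfl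
    rw [e, geo9Y_M]; positivity
  have hK' : 10 * (kGeo x.toKIdx).L * ((kGeo x.toKIdx).M * α₀) ≤ KT := hK
  exact hasMaj_JTcoKH_bHZKP_bHZP_of_reg335P x.toKIdx (trBasis N) (B := bg9YR (Matrix (Fin N) (Fin N) ℂ) (specialUnitaryUnits (Fin N)) R₁ R₂ x) (fun U => U) U
    (R₀ := (1 : ℝ)) (H₀ := H) hβ1 hcf hG1 hc10 hMα hK' hreg hs0 hs1 hδ ν

/-- ★★ **`hJT0` AT THE MEMBER**: the sup twin `J†_ν : 𝔠^{(−1)}_{blkBK (bI x)} → 𝔠^{(−1)}_{blkSK (sIK (bI x))}` at `trBasis N`, `bg9YR R₁ R₂ x`, SU(N)-valued regular `U`, under the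
member facts `Facts347 (geo9Y x) 1 (H x) …` (`B9RWSums347DefiniteFaces.facts347_exp261_geo9Y` above its threshold): constant `cR39 (trBasis N)·e^{δ·rJ}·L` with `L = ℓ + 1`
written as the literal cast (`(geo9Y x).L = ((ℓ + 1 : ℕ) : ℝ)` is `rfl`, `B9Ineq347Reading.geo9Y_L`), rate `δ − αδ_F`.
[cite: Balaban1985BackgroundPropagators, (3.8) p.392 + (3.42) p.397 + p.398 (remark after (3.47)) + (3.35) p.396; Balaban1984PropagatorsII, (2.51) p.232, Lemma 2.1 (2.60) p.234] -/
theorem hasMaj_JTcoKH_cNormR_neg_one_pinsR {R₁ R₂ : RegFamY d ℓ hd hL b₀ b₁ Mstar (Matrix (Fin N) (Fin N) ℂ)} (x : MemberY d ℓ hd hL b₀ b₁ Mstar)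
    {H : Prop} (hG : GeoOK (geo9Y x)) {dF : ℕ} {δF α L₀ : ℝ} (hF : Facts347 (geo9Y x) 1 H dF δF α L₀)
    {bI : FBondY x.toKIdx → IBondY x.toKIdx}
    (hβ1 : ∀ f : FBondY x.toKIdx, (geomT x.toKIdx.D).dist (β x.toKIdx.hN x.toKIdx.D x.toKIdx.hk (bI f)) (blkV1 x.toKIdx.hN x.toKIdx.D f) ≤ 1)
    {U : (bg9YR (Matrix (Fin N) (Fin N) ℂ) (specialUnitaryUnits (Fin N)) R₁ R₂ x).Cfg} {c10 α₀ : ℝ}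
    (hreg : (bg9KP (Matrix (Fin N) (Fin N) ℂ) (specialUnitaryUnits (Fin N)) x.toKIdx).Reg335 c10 α₀ U)
    {δ : ℝ} (hδ : 0 ≤ δ) (ν : Fin (d + 1)) :
    letI : Fintype (geo9K x.toKIdx).Site := (inferInstance : Fintype (geo9Y x).Site)
    HasMaj (cNormR (1 : ℝ) H (blkBK x.toKIdx bI) hG.lenle (-1)) (cNormR (1 : ℝ) H (blkSK x.toKIdx (sIK x.toKIdx bI)) hG.lenle (-1))
      (JTcoKH x.toKIdx (trBasis N) (bg9YR (Matrix (Fin N) (Fin N) ℂ) (specialUnitaryUnits (Fin N)) R₁ R₂ x) (fun U => U) ν U)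
      (fun a a' => cR39 (trBasis N) * Real.exp (δ * rJ d ℓ) * (((ℓ + 1 : ℕ) : ℝ)) * Real.exp (-((δ - α * δF) * (geo9Y x).dist a a'))) := by
  haveI : Nonempty (Fin N) := ⟨⟨0, Nat.pos_of_ne_zero (NeZero.ne N)⟩⟩
  letI : Fintype (geo9K x.toKIdx).Site := (inferInstance : Fintype (geo9Y x).Site)
  have hG1 : ∀ u : (Matrix (Fin N) (Fin N) ℂ)ˣ, u ∈ specialUnitaryUnits (Fin N) → ‖(u : Matrix (Fin N) (Fin N) ℂ)‖ ≤ 1 := fun u hu => (specialUnitaryUnits_le_U1 hu).1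
  have hUL : ∀ (μ' : Fin (d + 1)) (t : Site (PV d ℓ x.toKIdx.m x.toKIdx.K hd hL) 0), UnitaryLike (U μ' t) :=
    fun μ' t => norm_le_one_and_inv_of_mem (specialUnitaryUnits (Fin N)) hG1 (mem_of_reg335P x.toKIdx hreg μ' t)
  exact hasMaj_JTcoKH_cNormR_neg_one x.toKIdx (trBasis N) (B := bg9YR (Matrix (Fin N) (Fin N) ℂ) (specialUnitaryUnits (Fin N)) R₁ R₂ x) (fun U => U) U
    (R₀ := (1 : ℝ)) (H₀ := H) hG hF hUL hβ1 hδ ν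

end Members

end Literature.MathematicalPhysics.QuantumFieldTheory.Balaban1983to89.B9DivLetterTransportedAtPins

end
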